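/-
Copyright (c) 2026 the pub-hodgecm-mathlib formalisation cell (harness21).  Prover seat hodgecm-mathlib-K2E3-p25 (g2), HCML Track B «K2-LIT»,
h413 = `stmt-HodgeConjecture-24833`, unit U12 «Characters», PART «RANK» leaf (11-2qs-Id′) → (qs2-ps) «van Dijk₂», brick D119 (CLS₂-fun), FILE 2 (the `U(1,1)` instance).
2026-09-04.
-/
import Summits.HodgeConjecture.HodgeConjecture.Theorems.K2E3HyperbolicClassFunRecipe          -- ★ D119 file 1 `exists_classFun_of_recipe`
import Summits.HodgeConjecture.HodgeConjecture.Theorems.K2E3HyperbolicClassFunRecipeInputs    -- 📤 D119 file 1b `conj_regular_nhds_of_centralizer`, `exists_compact_representatives_of_iwasawa`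
import Summits.HodgeConjecture.HodgeConjecture.Theorems.F0P3cStCharTSWeylHypMeasure           -- ★ `isOpen_setOf_isRegularElt_torusU`, (CM) `isUnit_of_ne_zero_of_nonsplit`, `nontrivial_localRing`, (Torsor) `isRegularElt_coe_conj_iff`
import Summits.HodgeConjecture.HodgeConjecture.Theorems.K2E3RegularConjugationOpenNonsplit    -- ★ K2E3-p09 `conj_torus_mem_nhds_of_isRegularElt` (Harish-Chandra openness, any `N`)
import Literature.NumberTheory.Automorphic.UnitaryGroupCMLocalIwasawa                         -- ★ `exists_mem_cmLocalIntegralLevel_mul_borel` (`G = K_v · B`, any `N`)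
import Literature.NumberTheory.Automorphic.CMPrincipalSeriesJacquetEvalOne                    -- ★ `continuous_proj_borelTriple`
import Literature.NumberTheory.Automorphic.UnitaryGroupTorusOrbitalDescentNonsplitTwo         -- ★ `mul_comm_of_mem_torusU_cmLocal_two`
import Literature.NumberTheory.Automorphic.UnitaryGroupBorelInduction                         -- ★ `cmBorelTriple`, `isClosed_borelU`, `cmDatum_Local_eq`
import Literature.NumberTheory.Automorphic.LocalUnitaryIntegralLevel                          -- ★ `isCompact_isOpen_cmLocalIntegralLevel`
import Literature.NumberTheory.Automorphic.LocalUnitaryGroupCongr                             -- ★ `isUnit_antidiagOne_det`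
import HarnessLib

/-!
# K2_E3 road (h413), (qs2-ps) «van Dijk₂», brick D119 (CLS₂-fun), FILE 2 — CLASS FUNCTIONS ON THE HYPERBOLIC SET OF `G₂ = U(1,1)(L⁺_v)` (`v` non-split) FROM
# `W`-SYMMETRIC CONTINUOUS FUNCTIONS ON ITS SPLIT TORUS

Cell `pub/hodgecm-mathlib` (D-0151), Track B, seat K2E3-p25 (g2).  `--supports stmt-HodgeConjecture-24833 --as helper`; THEOREMS ONLY (no `def`, no instance, no notation,
no `sorry`); ★-only imports; never imports `Cruxes/…/Lines`.  COUNT-NEUTRAL.  The `N = 2` twin of ★ `K2E3HyperbolicClassFunOfTorus.exists_hyperbolicClassFun` (K2E3-p11,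
`N = 3`), obtained from the group-generic recipe (★ file 1) and its generic inputs (file 1b), HYPOTHESIS-FIRST in the two (WEYL₂) letters of K2E3-p14 (g7):
W2-a `hdich` (fibre dichotomy on `T₂^{reg}`) and W2-b `hcent` (the centraliser of a regular torus element is `T₂`), and in an abstract Weyl map `w : T₂ → T₂`
(instantiated by the (ASM₂) consumer with `t ↦ w₀ t w₀⁻¹`, ★ `CMBorelWeylTorusConjugateTwo.weylConj_mem_two`).

THE MATHEMATICS ([HarishChandra1970, Part I §3 Lemmas 19–20, Part V §3 Thm. 12]; [Rogawski1990, §12.5 p. 182]; [vanDijk1972, §2]).  `G₂ = U(1,1)(L⁺_v)`, `T₂` its split torus,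
`T₂^{reg}` the regular elements, `Ω₂ = {x ∣ ∃ t ∈ T₂^{reg}, t ~ x}`.  Inputs: `T₂^{reg}` open in `T₂` (★), regularity is conjugation invariant (★), Harish-Chandra's openness at
regular points (★ K2E3-p09, `N`-generic), Iwasawa `G₂ = K_v B` with the continuous Levi retraction `B → T₂` and `T₂` commutative (★) — whence (b) and (c) of the recipe by
file 1b — plus the letters W2-a∕W2-b.  **`exists_hyperbolicClassFun_two`**: for continuous `ψ : T₂ → ℂ` with `ψ ∘ w = ψ` on `T₂^{reg}` there is `N : G₂ → ℂ` measurable,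
conjugation invariant on `Ω₂`, `0` off `Ω₂`, `= ψ` on `T₂^{reg}`, bounded on compact sets.

HONEST LABEL: HC_CM is proved only modulo the 7 printed citations (2 remaining named inputs: hLiu418 = stmt-HodgeConjecture-24832, h413 = stmt-HodgeConjecture-24833) until rung 0
closes; count-neutral helper.

## References
* [HarishChandra1970] Harish-Chandra (notes by G. van Dijk), *Harmonic Analysis on Reductive p-adic Groups*, LNM 162 (1970), Part I §3 Lemmas 19–20; Part V §3 Thm. 12; Lemma 42.
* [Rogawski1990] J. D. Rogawski, *Automorphic Representations of Unitary Groups in Three Variables*, Ann. of Math. Stud. 123 (1990), §12.5 p. 182; §4.9 p. 54.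
* [vanDijk1972] G. van Dijk, *Computation of certain induced characters of 𝔭-adic groups*, Math. Ann. 199 (1972), §2.
-/

set_option autoImplicit false
set_option linter.dupNamespace false

noncomputable section

open Set Filter Topology NumberField IsDedekindDomain
open Literature.NumberTheory.Automorphic Literature.NumberTheory.Automorphic.UnitaryGroup Literature.NumberTheory.Rogawski1990
open Summit.HodgeConjecture.HodgeConjecture.Cruxes.H413.F0P3cStCharTSWeylHypMeasure
open Summit.HodgeConjecture.HodgeConjecture.Cruxes.H413.F0P3cStCharTSWeylHypCM
open Summit.HodgeConjecture.HodgeConjecture.Cruxes.H413.F0P3cStCharTSWeylHypTorsor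
open Summit.HodgeConjecture.HodgeConjecture.Cruxes.H413.K2E3HyperbolicClassFunRecipe
open Summit.HodgeConjecture.HodgeConjecture.Cruxes.H413.K2E3HyperbolicClassFunRecipeInputs

namespace Summit.HodgeConjecture.HodgeConjecture.Cruxes.H413.K2E3HyperbolicClassFunOfTorusTwo

variable (L : Type) [Field L] [NumberField L] [IsCMField L] (v : HeightOneSpectrum (𝓞 ↥(maximalRealSubfield L)))

/-- **CLASS FUNCTIONS ON THE HYPERBOLIC SET OF `U(1,1)(L⁺_v)` FROM `W`-SYMMETRIC TORUS FUNCTIONS** (`v` non-split), hypothesis-first in the (WEYL₂) letters W2-a (`hdich`)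
and W2-b (`hcent`) and in the Weyl map `w`. [cite: HarishChandra1970, Part V §3 Thm. 12; Part I §3 Lemmas 19–20] [cite: Rogawski1990, §12.5 p. 182] [cite: vanDijk1972, §2] -/
theorem exists_hyperbolicClassFun_two (hns : ∀ w : PlacesOver L v, IsCMField.complexConj L • w.1 = w.1)
    [MeasurableSpace ↥(unitaryGroupOfForm (conjLocal L (IsCMField.complexConj L) v) (cmLocalForm L 2 v))]
    [BorelSpace ↥(unitaryGroupOfForm (conjLocal L (IsCMField.complexConj L) v) (cmLocalForm L 2 v))]
    (w : ↥(cmBorelTriple L 2 v).M → ↥(cmBorelTriple L 2 v).M)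
    (hdich : ∀ t t' : ↥(cmBorelTriple L 2 v).M,
      IsRegularElt (((t : ↥(unitaryGroupOfForm (conjLocal L (IsCMField.complexConj L) v) (cmLocalForm L 2 v))) : GL (Fin 2) (LocalRing L v))) →
      IsRegularElt (((t' : ↥(unitaryGroupOfForm (conjLocal L (IsCMField.complexConj L) v) (cmLocalForm L 2 v))) : GL (Fin 2) (LocalRing L v))) →
      IsConj (t : ↥(unitaryGroupOfForm (conjLocal L (IsCMField.complexConj L) v) (cmLocalForm L 2 v))) (t' : ↥(unitaryGroupOfForm (conjLocal L (IsCMField.complexConj L) v) (cmLocalForm L 2 v))) →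
      t' = t ∨ t' = w t)
    (hcent : ∀ t₀ : ↥(cmBorelTriple L 2 v).M,
      IsRegularElt (((t₀ : ↥(unitaryGroupOfForm (conjLocal L (IsCMField.complexConj L) v) (cmLocalForm L 2 v))) : GL (Fin 2) (LocalRing L v))) →
      Subgroup.centralizer ({(t₀ : ↥(unitaryGroupOfForm (conjLocal L (IsCMField.complexConj L) v) (cmLocalForm L 2 v)))} :
        Set ↥(unitaryGroupOfForm (conjLocal L (IsCMField.complexConj L) v) (cmLocalForm L 2 v))) = (cmBorelTriple L 2 v).M)
    (ψ : ↥(cmBorelTriple L 2 v).M → ℂ) (hψ : Continuous ψ)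
    (hψw : ∀ t : ↥(cmBorelTriple L 2 v).M,
      IsRegularElt (((t : ↥(unitaryGroupOfForm (conjLocal L (IsCMField.complexConj L) v) (cmLocalForm L 2 v))) : GL (Fin 2) (LocalRing L v))) → ψ (w t) = ψ t) :
    ∃ N : ↥(unitaryGroupOfForm (conjLocal L (IsCMField.complexConj L) v) (cmLocalForm L 2 v)) → ℂ, Measurable N ∧
      (∀ x : ↥(unitaryGroupOfForm (conjLocal L (IsCMField.complexConj L) v) (cmLocalForm L 2 v)),
        x ∈ {x : ↥(unitaryGroupOfForm (conjLocal L (IsCMField.complexConj L) v) (cmLocalForm L 2 v)) | ∃ t : ↥(cmBorelTriple L 2 v).M,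
          t ∈ {t : ↥(cmBorelTriple L 2 v).M | IsRegularElt (((t : ↥(unitaryGroupOfForm (conjLocal L (IsCMField.complexConj L) v) (cmLocalForm L 2 v))) : GL (Fin 2) (LocalRing L v)))} ∧
          IsConj (t : ↥(unitaryGroupOfForm (conjLocal L (IsCMField.complexConj L) v) (cmLocalForm L 2 v))) x} →
        ∀ h : ↥(unitaryGroupOfForm (conjLocal L (IsCMField.complexConj L) v) (cmLocalForm L 2 v)), N (h * x * h⁻¹) = N x) ∧
      (∀ x : ↥(unitaryGroupOfForm (conjLocal L (IsCMField.complexConj L) v) (cmLocalForm L 2 v)),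
        x ∉ {x : ↥(unitaryGroupOfForm (conjLocal L (IsCMField.complexConj L) v) (cmLocalForm L 2 v)) | ∃ t : ↥(cmBorelTriple L 2 v).M,
          t ∈ {t : ↥(cmBorelTriple L 2 v).M | IsRegularElt (((t : ↥(unitaryGroupOfForm (conjLocal L (IsCMField.complexConj L) v) (cmLocalForm L 2 v))) : GL (Fin 2) (LocalRing L v)))} ∧
          IsConj (t : ↥(unitaryGroupOfForm (conjLocal L (IsCMField.complexConj L) v) (cmLocalForm L 2 v))) x} → N x = 0) ∧
      (∀ t : ↥(cmBorelTriple L 2 v).M,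
        IsRegularElt (((t : ↥(unitaryGroupOfForm (conjLocal L (IsCMField.complexConj L) v) (cmLocalForm L 2 v))) : GL (Fin 2) (LocalRing L v))) →
          N (t : ↥(unitaryGroupOfForm (conjLocal L (IsCMField.complexConj L) v) (cmLocalForm L 2 v))) = ψ t) ∧
      (∀ K : Set ↥(unitaryGroupOfForm (conjLocal L (IsCMField.complexConj L) v) (cmLocalForm L 2 v)), IsCompact K → ∃ B : ℝ, ∀ x ∈ K, ‖N x‖ ≤ B) := by
  haveI : Nontrivial (LocalRing L v) := F0P3cStCharTSWeylHypCM.nontrivial_localRing L v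
  have hR := isUnit_of_ne_zero_of_nonsplit L v hns
  obtain ⟨wv⟩ := (inferInstance : Nonempty (PlacesOver L v))
  -- (b) openness, from Harish-Chandra's lemma (★ K2E3-p09) and the letter W2-b
  have hRegOpen : IsOpen {t : ↥(cmBorelTriple L 2 v).M |
      IsRegularElt (((t : ↥(unitaryGroupOfForm (conjLocal L (IsCMField.complexConj L) v) (cmLocalForm L 2 v))) : GL (Fin 2) (LocalRing L v)))} :=
    isOpen_setOf_isRegularElt_torusU (conjLocal L (IsCMField.complexConj L) v) (cmLocalForm L 2 v) hR
  have hRegConj : ∀ c g : ↥(unitaryGroupOfForm (conjLocal L (IsCMField.complexConj L) v) (cmLocalForm L 2 v)),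
      IsRegularElt (((c * g * c⁻¹ : ↥(unitaryGroupOfForm (conjLocal L (IsCMField.complexConj L) v) (cmLocalForm L 2 v))) : GL (Fin 2) (LocalRing L v))) ↔
        IsRegularElt ((g : ↥(unitaryGroupOfForm (conjLocal L (IsCMField.complexConj L) v) (cmLocalForm L 2 v))) : GL (Fin 2) (LocalRing L v)) :=
    fun c g => isRegularElt_coe_conj_iff _ _ c g
  have hHC : ∀ γ₀ : ↥(unitaryGroupOfForm (conjLocal L (IsCMField.complexConj L) v) (cmLocalForm L 2 v)),
      IsRegularElt ((γ₀ : ↥(unitaryGroupOfForm (conjLocal L (IsCMField.complexConj L) v) (cmLocalForm L 2 v))) : GL (Fin 2) (LocalRing L v)) →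
      ∀ O : Set ↥(unitaryGroupOfForm (conjLocal L (IsCMField.complexConj L) v) (cmLocalForm L 2 v)), O ∈ 𝓝 γ₀ →
        {g : ↥(unitaryGroupOfForm (conjLocal L (IsCMField.complexConj L) v) (cmLocalForm L 2 v)) |
          ∃ (x : ↥(unitaryGroupOfForm (conjLocal L (IsCMField.complexConj L) v) (cmLocalForm L 2 v)))
            (t : ↥(Subgroup.centralizer ({γ₀} : Set ↥(unitaryGroupOfForm (conjLocal L (IsCMField.complexConj L) v) (cmLocalForm L 2 v))))),
            (t : ↥(unitaryGroupOfForm (conjLocal L (IsCMField.complexConj L) v) (cmLocalForm L 2 v))) ∈ O ∧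
              g = x * (t : ↥(unitaryGroupOfForm (conjLocal L (IsCMField.complexConj L) v) (cmLocalForm L 2 v))) * x⁻¹} ∈ 𝓝 γ₀ := by
    intro γ₀ hγ₀ O hO
    have h := K2E3RegularConjugationOpenNonsplit.conj_torus_mem_nhds_of_isRegularElt L
      (Matrix.of fun i j : Fin 2 => if i.val + j.val + 1 = 2 then (1 : L) else 0) (isUnit_antidiagOne_det L 2) wv (hns wv) γ₀ hγ₀ (W := univ) univ_mem hO
    refine mem_of_superset h ?_
    rintro g ⟨x, -, t, htO, rfl⟩
    exact ⟨x, t, htO, rfl⟩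
  have hopen := fun (t₀ : ↥(cmBorelTriple L 2 v).M)
      (ht₀ : t₀ ∈ {t : ↥(cmBorelTriple L 2 v).M | IsRegularElt (((t : ↥(unitaryGroupOfForm (conjLocal L (IsCMField.complexConj L) v) (cmLocalForm L 2 v))) : GL (Fin 2) (LocalRing L v)))})
      (c : ↥(unitaryGroupOfForm (conjLocal L (IsCMField.complexConj L) v) (cmLocalForm L 2 v))) (V : Set ↥(cmBorelTriple L 2 v).M) (hV : V ∈ 𝓝 t₀) =>
    conj_regular_nhds_of_centralizer (T := (cmBorelTriple L 2 v).M)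
      (fun g : ↥(unitaryGroupOfForm (conjLocal L (IsCMField.complexConj L) v) (cmLocalForm L 2 v)) =>
        IsRegularElt ((g : ↥(unitaryGroupOfForm (conjLocal L (IsCMField.complexConj L) v) (cmLocalForm L 2 v))) : GL (Fin 2) (LocalRing L v)))
      hRegOpen hRegConj hcent hHC t₀ ht₀ c hV
  -- (c) compact representatives, from Iwasawa `G₂ = K_v · B`
  have hPcl : IsClosed (((cmBorelTriple L 2 v).P : Subgroup ↥(unitaryGroupOfForm (conjLocal L (IsCMField.complexConj L) v) (cmLocalForm L 2 v))) :
      Set ↥(unitaryGroupOfForm (conjLocal L (IsCMField.complexConj L) v) (cmLocalForm L 2 v))) :=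
    isClosed_borelU (conjLocal L (IsCMField.complexConj L) v) (cmLocalForm L 2 v)
  obtain ⟨KU, hKU⟩ : ∃ KU : Subgroup ↥(unitaryGroupOfForm (conjLocal L (IsCMField.complexConj L) v) (cmLocalForm L 2 v)),
      KU = cmLocalIntegralLevel L 2 (Matrix.of fun i j : Fin 2 => if i.val + j.val + 1 = 2 then (1 : L) else 0) v := ⟨_, rfl⟩
  have hK₁ : IsCompact (KU : Set ↥(unitaryGroupOfForm (conjLocal L (IsCMField.complexConj L) v) (cmLocalForm L 2 v))) := by
    rw [hKU]; exact (isCompact_isOpen_cmLocalIntegralLevel L 2 (Matrix.of fun i j : Fin 2 => if i.val + j.val + 1 = 2 then (1 : L) else 0) v).1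
  have hIw : ∀ c : ↥(unitaryGroupOfForm (conjLocal L (IsCMField.complexConj L) v) (cmLocalForm L 2 v)),
      ∃ κ ∈ (KU : Set ↥(unitaryGroupOfForm (conjLocal L (IsCMField.complexConj L) v) (cmLocalForm L 2 v))),
        ∃ b : ↥(cmBorelTriple L 2 v).P, c = κ * (b : ↥(unitaryGroupOfForm (conjLocal L (IsCMField.complexConj L) v) (cmLocalForm L 2 v))) := by
    intro c
    obtain ⟨κ, hκ, b, hcb⟩ := exists_mem_cmLocalIntegralLevel_mul_borel L 2 v c
    exact ⟨κ, by rw [SetLike.mem_coe, hKU]; exact hκ, b, hcb⟩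
  have hcpt := fun (K : Set ↥(unitaryGroupOfForm (conjLocal L (IsCMField.complexConj L) v) (cmLocalForm L 2 v))) (hK : IsCompact K) =>
    exists_compact_representatives_of_iwasawa (cmBorelTriple L 2 v).M_le hPcl (cmBorelTriple L 2 v).proj
      (continuous_proj_borelTriple (conjLocal L (IsCMField.complexConj L) v) (cmLocalForm L 2 v) (cmLocalForm_eq_over L 2 v))
      (fun p hp => (cmBorelTriple L 2 v).proj_apply_of_mem_M p hp)
      (fun s t => Subtype.ext (mul_comm_of_mem_torusU_cmLocal_two L v s.2 t.2)) hK₁ hIw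
      {t : ↥(cmBorelTriple L 2 v).M | IsRegularElt (((t : ↥(unitaryGroupOfForm (conjLocal L (IsCMField.complexConj L) v) (cmLocalForm L 2 v))) : GL (Fin 2) (LocalRing L v)))} hK
  exact exists_classFun_of_recipe
    {t : ↥(cmBorelTriple L 2 v).M | IsRegularElt (((t : ↥(unitaryGroupOfForm (conjLocal L (IsCMField.complexConj L) v) (cmLocalForm L 2 v))) : GL (Fin 2) (LocalRing L v)))}
    w (fun t t' ht ht' h => hdich t t' ht ht' h) hopen ψ (fun t ht => hψw t ht) hψ hcpt

end Summit.HodgeConjecture.HodgeConjecture.Cruxes.H413.K2E3HyperbolicClassFunOfTorusTwo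

end
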